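import Mathlib.Geometry.Euclidean.Volume.Measure
import Mathlib.Analysis.InnerProductSpace.Projection.FiniteDimensional
import Mathlib.Analysis.InnerProductSpace.Calculus
import Mathlib.Analysis.Calculus.MeanValue
import Mathlib.Analysis.SpecialFunctions.Sqrt
import Mathlib.MeasureTheory.Measure.Lebesgue.VolumeOfBalls
import HarnessLib

/-!
# Spherical caps as Lipschitz graphs: two-sided bounds for their Hausdorff measure

Support file (all results proved) for the area of the round `2`-sphere with respect to Mathlib's
Euclidean (normalised) Hausdorff measure `μHE[2]` (`SphereArea.lean`:
`μHE[2] {‖x‖ = r} = 4π r²` in a `3`-dimensional real inner product space), which in turn is what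
every numerical value of an ADM energy needs (`Literature.Geometry.Lorentzian.AFEnd.admEnergyFlux`
integrates over coordinate spheres against `μHE[2]`).

For a unit vector `v` of a real inner product space `E` and `0 < c < 1`, the open cap
`cap v c = {‖x‖ = 1, ⟪v, x⟫ > c}` of the unit sphere is compared with the disc of radius
`ρ = √(1 - c²)` in the hyperplane `K = (ℝ ∙ v)ᗮ`:

* the orthogonal projection `E → K` is `1`-Lipschitz and maps the cap onto the disc
  (`ball_subset_image_cap`), and the graph map `capLift v : y ↦ y + √(1 - ‖y‖²) v` maps the disc
  onto the cap (`cap_subset_image_capLift`) and is Lipschitz with constant `1 + ρ/√(1 - ρ²)` on it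
  (`lipschitzOnWith_capLift`, from the derivative bound `‖D capLift(y)‖ ≤ 1 + ‖y‖/√(1 - ‖y‖²)`
  and the mean value inequality on the convex disc);
* Lipschitz maps increase `μH[d]` at most by `K^d` (Mathlib), hence also `μHE[d]`, a constant
  multiple (`LipschitzOnWith.euclideanHausdorffMeasure_image_le`); and on a `2`-dimensional inner
  product space `μHE[2]` is Lebesgue measure, so the disc has measure `π ρ²`
  (`euclideanHausdorffMeasure_ball_of_finrank_two`);
* therefore, when `K` is `2`-dimensional,
  `π (1 - c²) ≤ μHE[2] (cap v c) ≤ (1 + √(1 - c²)/c)² π (1 - c²)`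
  (`le_euclideanHausdorffMeasure_cap`, `euclideanHausdorffMeasure_cap_le`): both bounds are
  `π (1 - c²)(1 + o(1))` as `c → 1`.

Mathlib has Hausdorff measures, their behaviour under Lipschitz and isometric maps and the
identification `μHE[dim] = volume`, but no area formula and no value of `μH` on any curved set.

## References

* P. Mattila, *Geometry of sets and measures in Euclidean spaces* (CUP 1995), §4 (Hausdorff
  measures under Lipschitz maps), Thm. 3.4.
* H. Federer, *Geometric measure theory* (1969), 2.10.11, 3.2.3.
-/

noncomputable section

open Set Metric Module Submodule Filter
open _root_.MeasureTheory _root_.MeasureTheory.Measure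
open scoped ENNReal NNReal Topology RealInnerProductSpace Pointwise

namespace Literature.MeasureTheory.Hausdorff

/-! ### Lipschitz images and the Euclidean Hausdorff measure -/

/-- **Lipschitz maps and the Euclidean Hausdorff measure.** If `f` is `C`-Lipschitz on `s`, then
`μHE[d] (f '' s) ≤ C^d · μHE[d] s` (Mathlib's `LipschitzOnWith.hausdorffMeasure_image_le` for
`μH[d]`; `μHE[d]` is the same constant multiple of `μH[d]` on every space). Deliberately declared
in Mathlib's `LipschitzOnWith` namespace, as the dot-notation companion of that lemma.
Mattila 1995, §4. [folklore] -/
theorem _root_.LipschitzOnWith.euclideanHausdorffMeasure_image_le {X Y : Type*} [EMetricSpace X]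
    [MeasurableSpace X] [BorelSpace X] [EMetricSpace Y] [MeasurableSpace Y] [BorelSpace Y]
    {C : ℝ≥0} {f : X → Y} {s : Set X} (h : LipschitzOnWith C f s) (d : ℕ) :
    (μHE[d] : Measure Y) (f '' s) ≤ (C : ℝ≥0∞) ^ d * (μHE[d] : Measure X) s := by
  have h1 := h.hausdorffMeasure_image_le (d := (d : ℝ)) (Nat.cast_nonneg d)
  rw [ENNReal.rpow_natCast] at h1
  simp only [Measure.euclideanHausdorffMeasure_def, Measure.smul_apply, ENNReal.smul_def, smul_eq_mul]
  calc _ ≤ (addHaarScalarFactor (volume : Measure (EuclideanSpace ℝ (Fin d))) μH[d] : ℝ≥0∞) *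
        ((C : ℝ≥0∞) ^ d * μH[d] s) := mul_le_mul_right h1 _
    _ = _ := by ring

/-! ### Discs in a plane -/

/-- **Area of a disc as a Hausdorff measure.** On a `2`-dimensional real inner product space `K`,
`μHE[2]` is Lebesgue measure (`InnerProductSpace.euclideanHausdorffMeasure_eq_volume`), so the
disc of radius `ρ ≥ 0` has `μHE[2]`-measure `π ρ²`. [folklore] -/
theorem euclideanHausdorffMeasure_ball_of_finrank_two {K : Type*} [NormedAddCommGroup K]
    [InnerProductSpace ℝ K] [FiniteDimensional ℝ K] [MeasurableSpace K] [BorelSpace K]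
    (hK : finrank ℝ K = 2) {ρ : ℝ} (hρ : 0 ≤ ρ) :
    (μHE[2] : Measure K) (ball 0 ρ) = ENNReal.ofReal (Real.pi * ρ ^ 2) := by
  have h := InnerProductSpace.euclideanHausdorffMeasure_eq_volume (V := K)
  rw [hK] at h
  haveI : Nontrivial K := Module.nontrivial_of_finrank_pos (R := ℝ) (by omega)
  rw [h, InnerProductSpace.volume_ball_of_dim_even (k := 1) (by simpa using hK), hK,
    ← ENNReal.ofReal_pow hρ, ← ENNReal.ofReal_mul (by positivity)]
  congr 1
  simp [mul_comm]

/-! ### Spherical caps as Lipschitz graphs over the tangent plane -/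

variable {E : Type*} [NormedAddCommGroup E] [InnerProductSpace ℝ E]

/-- The **open spherical cap** of the unit sphere of height parameter `c` around the pole `v`:
the points `x` of the unit sphere with `⟪v, x⟫ > c` (for `‖v‖ = 1`, `0 < c < 1` this is the
geodesic ball of radius `arccos c` around `v`). [folklore] -/
def cap (v : E) (c : ℝ) : Set E := {x | ‖x‖ = 1 ∧ c < ⟪v, x⟫}

/-- The **graph map** over the hyperplane orthogonal to `v`: `y ↦ y + √(1 - ‖y‖²) v`, which
parametrises the upper unit hemisphere by the unit disc of `(ℝ ∙ v)ᗮ`. [folklore] -/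
def capLift (v : E) (y : (ℝ ∙ v)ᗮ) : E := (y : E) + Real.sqrt (1 - ‖y‖ ^ 2) • v

variable {v : E}

/-- Vectors of `(ℝ ∙ v)ᗮ` are orthogonal to `v`. [folklore] -/
theorem inner_pole_eq_zero (y : (ℝ ∙ v)ᗮ) : ⟪v, (y : E)⟫ = 0 :=
  (mem_orthogonal_singleton_iff_inner_right).1 y.2

/-- The graph map takes values in the unit sphere (`‖v‖ = 1`, `‖y‖ ≤ 1`). [folklore] -/
theorem norm_capLift (hv : ‖v‖ = 1) {y : (ℝ ∙ v)ᗮ} (hy : ‖y‖ ≤ 1) : ‖capLift v y‖ = 1 := by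
  have h0 : ⟪(y : E), v⟫ = 0 := by rw [real_inner_comm]; exact inner_pole_eq_zero y
  have h0' : ⟪v, (y : E)⟫ = 0 := inner_pole_eq_zero y
  have h1 : 0 ≤ 1 - ‖y‖ ^ 2 := by nlinarith [norm_nonneg y]
  have hs : Real.sqrt (1 - ‖y‖ ^ 2) * Real.sqrt (1 - ‖y‖ ^ 2) = 1 - ‖y‖ ^ 2 :=
    Real.mul_self_sqrt h1
  have hn : ‖(y : E)‖ = ‖y‖ := Submodule.norm_coe y
  have : ‖capLift v y‖ ^ 2 = 1 := by
    rw [capLift, ← real_inner_self_eq_norm_sq]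
    simp only [inner_add_left, inner_add_right, inner_smul_left, inner_smul_right, h0, h0',
      real_inner_self_eq_norm_sq, hv, RCLike.conj_to_real, hn]
    linear_combination hs
  have h2 : 0 ≤ ‖capLift v y‖ := norm_nonneg _
  nlinarith

/-- The height of the lifted point: `⟪v, capLift v y⟫ = √(1 - ‖y‖²)`. [folklore] -/
theorem inner_capLift (hv : ‖v‖ = 1) (y : (ℝ ∙ v)ᗮ) :
    ⟪v, capLift v y⟫ = Real.sqrt (1 - ‖y‖ ^ 2) := by
  rw [capLift, inner_add_right, inner_pole_eq_zero, inner_smul_right,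
    real_inner_self_eq_norm_sq, hv]
  ring

/-- The graph map sends the disc of radius `√(1 - c²)` into the cap of height `c`. [folklore] -/
theorem capLift_mem_cap (hv : ‖v‖ = 1) {c : ℝ} (hc0 : 0 < c) {y : (ℝ ∙ v)ᗮ}
    (hy : ‖y‖ < Real.sqrt (1 - c ^ 2)) : capLift v y ∈ cap v c := by
  have hρ1 : Real.sqrt (1 - c ^ 2) < 1 := by
    rw [Real.sqrt_lt' one_pos]; nlinarith
  refine ⟨norm_capLift hv (hy.le.trans hρ1.le), ?_⟩
  rw [inner_capLift hv]
  have hy2 : ‖y‖ ^ 2 < 1 - c ^ 2 := by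
    have h := hy
    rw [Real.lt_sqrt (norm_nonneg _)] at h
    exact h
  calc c = Real.sqrt (c ^ 2) := (Real.sqrt_sq hc0.le).symm
    _ < Real.sqrt (1 - ‖y‖ ^ 2) := Real.sqrt_lt_sqrt (sq_nonneg _) (by linarith)

/-- The orthogonal projection to the plane inverts the graph map. [folklore] -/
theorem orthogonalProjectionOnto_capLift (y : (ℝ ∙ v)ᗮ) :
    (ℝ ∙ v)ᗮ.orthogonalProjectionOnto (capLift v y) = y := by
  rw [capLift, map_add, map_smul, orthogonalProjectionOnto_mem_subspace_eq_self,
    orthogonalProjectionOnto_orthogonalComplement_singleton_eq_zero, smul_zero, add_zero]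

/-- Decomposition of a vector along `v` and the plane orthogonal to it (`‖v‖ = 1`). [folklore] -/
theorem coe_orthogonalProjectionOnto_orthogonal_singleton (hv : ‖v‖ = 1) (x : E) :
    ((ℝ ∙ v)ᗮ.orthogonalProjectionOnto x : E) = x - ⟪v, x⟫ • v := by
  have h := starProjection_add_starProjection_orthogonal (K := ℝ ∙ v) x
  rw [starProjection_singleton, hv] at h
  simp only [RCLike.ofReal_real_eq_id, id, one_pow, div_one] at h
  rw [coe_orthogonalProjectionOnto_apply, eq_sub_iff_add_eq, add_comm]
  exact h

/-- Pythagoras for the projection to the hyperplane orthogonal to a unit vector: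
`‖P x‖² = ‖x‖² - ⟪v, x⟫²`. [folklore] -/
theorem norm_sq_orthogonalProjectionOnto_orthogonal_singleton (hv : ‖v‖ = 1) (x : E) :
    ‖(ℝ ∙ v)ᗮ.orthogonalProjectionOnto x‖ ^ 2 = ‖x‖ ^ 2 - ⟪v, x⟫ ^ 2 := by
  rw [Submodule.coe_norm, coe_orthogonalProjectionOnto_orthogonal_singleton hv,
    ← real_inner_self_eq_norm_sq, ← real_inner_self_eq_norm_sq (x := x)]
  simp only [inner_sub_left, inner_sub_right, inner_smul_left, inner_smul_right,
    real_inner_self_eq_norm_sq, hv, real_inner_comm x v, RCLike.conj_to_real]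
  ring

/-- A point of the cap is the lift of its projection. [folklore] -/
theorem capLift_orthogonalProjectionOnto (hv : ‖v‖ = 1) {c : ℝ} (hc0 : 0 < c) {x : E}
    (hx : x ∈ cap v c) : capLift v ((ℝ ∙ v)ᗮ.orthogonalProjectionOnto x) = x := by
  obtain ⟨hx1, hxc⟩ := hx
  have hpos : 0 < ⟪v, x⟫ := hc0.trans hxc
  rw [capLift, norm_sq_orthogonalProjectionOnto_orthogonal_singleton hv, hx1,
    coe_orthogonalProjectionOnto_orthogonal_singleton hv]
  have : 1 - (1 ^ 2 - ⟪v, x⟫ ^ 2) = ⟪v, x⟫ ^ 2 := by ring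
  rw [this, Real.sqrt_sq hpos.le]
  abel

/-- The projection of a point of the cap of height `c` lies in the disc of radius `√(1 - c²)`. [folklore] -/
theorem norm_orthogonalProjectionOnto_lt (hv : ‖v‖ = 1) {c : ℝ} (hc0 : 0 < c) {x : E}
    (hx : x ∈ cap v c) : ‖(ℝ ∙ v)ᗮ.orthogonalProjectionOnto x‖ < Real.sqrt (1 - c ^ 2) := by
  obtain ⟨hx1, hxc⟩ := hx
  rw [Real.lt_sqrt (norm_nonneg _), norm_sq_orthogonalProjectionOnto_orthogonal_singleton hv, hx1]
  nlinarith

/-- The cap of height `c` is the image of the disc of radius `√(1 - c²)` under the graph map. [folklore] -/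
theorem cap_subset_image_capLift (hv : ‖v‖ = 1) {c : ℝ} (hc0 : 0 < c) :
    cap v c ⊆ capLift v '' ball (0 : (ℝ ∙ v)ᗮ) (Real.sqrt (1 - c ^ 2)) := fun x hx ↦
  ⟨(ℝ ∙ v)ᗮ.orthogonalProjectionOnto x,
    by rw [mem_ball_zero_iff]; exact norm_orthogonalProjectionOnto_lt hv hc0 hx,
    capLift_orthogonalProjectionOnto hv hc0 hx⟩

/-- The disc of radius `√(1 - c²)` is the projection of the cap of height `c`. [folklore] -/
theorem ball_subset_image_cap (hv : ‖v‖ = 1) {c : ℝ} (hc0 : 0 < c) :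
    ball (0 : (ℝ ∙ v)ᗮ) (Real.sqrt (1 - c ^ 2)) ⊆ (ℝ ∙ v)ᗮ.orthogonalProjectionOnto '' cap v c :=
  fun y hy ↦ ⟨capLift v y, capLift_mem_cap hv hc0 (by rwa [mem_ball_zero_iff] at hy),
    orthogonalProjectionOnto_capLift y⟩

/-! ### The graph map is Lipschitz with constant close to `1` on small discs -/

/-- The derivative of the graph map. [folklore] -/
theorem hasFDerivAt_capLift (v : E) {y : (ℝ ∙ v)ᗮ} (hy : ‖y‖ < 1) :
    HasFDerivAt (capLift v)
      ((ℝ ∙ v)ᗮ.subtypeL +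
        ((1 / (2 * Real.sqrt (1 - ‖y‖ ^ 2))) • (-(2 • innerSL ℝ y))).smulRight v) y := by
  have h1 : HasFDerivAt (fun y : (ℝ ∙ v)ᗮ ↦ 1 - ‖y‖ ^ 2) (-(2 • innerSL ℝ y)) y :=
    (hasStrictFDerivAt_norm_sq y).hasFDerivAt.const_sub 1
  have h2 : 1 - ‖y‖ ^ 2 ≠ 0 := by nlinarith [norm_nonneg y]
  have h3 := (h1.sqrt h2).smul_const v
  have h4 : HasFDerivAt (fun y : (ℝ ∙ v)ᗮ ↦ (y : E)) (ℝ ∙ v)ᗮ.subtypeL y :=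
    ((ℝ ∙ v)ᗮ.subtypeL).hasFDerivAt
  exact h4.add h3

/-- The derivative bound `‖D capLift(y)‖ ≤ 1 + ‖y‖/√(1 - ‖y‖²)` (`‖v‖ = 1`, `‖y‖ < 1`). [folklore] -/
theorem norm_fderiv_capLift_le (v : E) (hv : ‖v‖ = 1) {y : (ℝ ∙ v)ᗮ} (hy : ‖y‖ < 1) :
    ‖(ℝ ∙ v)ᗮ.subtypeL +
        ((1 / (2 * Real.sqrt (1 - ‖y‖ ^ 2))) • (-(2 • innerSL ℝ y))).smulRight v‖ ≤
      1 + ‖y‖ / Real.sqrt (1 - ‖y‖ ^ 2) := by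
  have hs : 0 < Real.sqrt (1 - ‖y‖ ^ 2) := Real.sqrt_pos.2 (by nlinarith [norm_nonneg y])
  have hA : ‖(ℝ ∙ v)ᗮ.subtypeL‖ ≤ 1 := Submodule.norm_subtypeL_le _
  have hB : ‖((1 / (2 * Real.sqrt (1 - ‖y‖ ^ 2))) • (-(2 • innerSL ℝ y))).smulRight v‖ ≤
      ‖y‖ / Real.sqrt (1 - ‖y‖ ^ 2) := by
    rw [ContinuousLinearMap.norm_smulRight_apply, hv, mul_one, norm_smul, norm_neg,
      Real.norm_eq_abs, abs_of_pos (by positivity)]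
    have h2 : ‖2 • innerSL ℝ y‖ ≤ 2 * ‖y‖ := by
      refine norm_nsmul_le.trans ?_
      rw [innerSL_apply_norm]
      norm_num
    calc 1 / (2 * Real.sqrt (1 - ‖y‖ ^ 2)) * ‖2 • innerSL ℝ y‖
        ≤ 1 / (2 * Real.sqrt (1 - ‖y‖ ^ 2)) * (2 * ‖y‖) :=
          mul_le_mul_of_nonneg_left h2 (by positivity)
      _ = ‖y‖ / Real.sqrt (1 - ‖y‖ ^ 2) := by field_simp
  have h := norm_add_le ((ℝ ∙ v)ᗮ.subtypeL)
    (((1 / (2 * Real.sqrt (1 - ‖y‖ ^ 2))) • (-(2 • innerSL ℝ y))).smulRight v)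
  exact h.trans (add_le_add hA hB)

/-- On the disc of radius `ρ < 1` the graph map is Lipschitz with constant `1 + ρ/√(1 - ρ²)`. [folklore] -/
theorem lipschitzOnWith_capLift (hv : ‖v‖ = 1) {ρ : ℝ} (hρ0 : 0 ≤ ρ) (hρ1 : ρ < 1) :
    LipschitzOnWith (Real.toNNReal (1 + ρ / Real.sqrt (1 - ρ ^ 2))) (capLift v)
      (ball (0 : (ℝ ∙ v)ᗮ) ρ) := by
  refine (convex_ball _ _).lipschitzOnWith_of_nnnorm_hasFDerivWithin_le (𝕜 := ℝ)
    (fun y hy ↦ (hasFDerivAt_capLift v ?_).hasFDerivWithinAt) (fun y hy ↦ ?_)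
  · rw [mem_ball_zero_iff] at hy; exact hy.trans hρ1
  · rw [mem_ball_zero_iff] at hy
    have hy1 : ‖y‖ < 1 := hy.trans hρ1
    rw [← NNReal.coe_le_coe, coe_nnnorm, Real.coe_toNNReal _ (by positivity)]
    refine (norm_fderiv_capLift_le v hv hy1).trans (add_le_add le_rfl ?_)
    have hs : 0 < Real.sqrt (1 - ρ ^ 2) := Real.sqrt_pos.2 (by nlinarith)
    have hsy : Real.sqrt (1 - ρ ^ 2) ≤ Real.sqrt (1 - ‖y‖ ^ 2) :=
      Real.sqrt_le_sqrt (by nlinarith [norm_nonneg y])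
    calc ‖y‖ / Real.sqrt (1 - ‖y‖ ^ 2) ≤ ρ / Real.sqrt (1 - ‖y‖ ^ 2) :=
          div_le_div_of_nonneg_right hy.le (hs.trans_le hsy).le
      _ ≤ ρ / Real.sqrt (1 - ρ ^ 2) := div_le_div_of_nonneg_left hρ0 hs hsy


/-! ### The Hausdorff measure of a cap, squeezed between planar discs -/

section Measure

variable [MeasurableSpace E] [BorelSpace E]

/-- **Lower bound**: the cap of height `c` has `μHE[2]`-measure at least the area `π (1 - c²)`
of the disc onto which it projects (`1`-Lipschitz orthogonal projection), when the plane
orthogonal to `v` is `2`-dimensional. [folklore] -/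
theorem le_euclideanHausdorffMeasure_cap (hv : ‖v‖ = 1) (hK : finrank ℝ (ℝ ∙ v)ᗮ = 2)
    [FiniteDimensional ℝ (ℝ ∙ v)ᗮ] {c : ℝ} (hc0 : 0 < c) (hc1 : c < 1) :
    ENNReal.ofReal (Real.pi * (1 - c ^ 2)) ≤ (μHE[2] : Measure E) (cap v c) := by
  have hρ : 0 ≤ Real.sqrt (1 - c ^ 2) := Real.sqrt_nonneg _
  have h1 : (μHE[2] : Measure (ℝ ∙ v)ᗮ) (ball 0 (Real.sqrt (1 - c ^ 2))) =
      ENNReal.ofReal (Real.pi * (1 - c ^ 2)) := by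
    rw [euclideanHausdorffMeasure_ball_of_finrank_two hK hρ, Real.sq_sqrt (by nlinarith)]
  have h2 := ((ℝ ∙ v)ᗮ.lipschitzWith_orthogonalProjectionOnto.lipschitzOnWith
    (s := cap v c)).euclideanHausdorffMeasure_image_le 2
  rw [ENNReal.coe_one, one_pow, one_mul] at h2
  rw [← h1]
  exact (measure_mono (ball_subset_image_cap hv hc0)).trans h2

/-- **Upper bound**: the cap of height `c` has `μHE[2]`-measure at most
`(1 + √(1 - c²)/c)² · π (1 - c²)` (Lipschitz graph over the disc of radius `√(1 - c²)`). [folklore] -/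
theorem euclideanHausdorffMeasure_cap_le (hv : ‖v‖ = 1) (hK : finrank ℝ (ℝ ∙ v)ᗮ = 2)
    [FiniteDimensional ℝ (ℝ ∙ v)ᗮ] {c : ℝ} (hc0 : 0 < c) (hc1 : c < 1) :
    (μHE[2] : Measure E) (cap v c) ≤
      ENNReal.ofReal ((1 + Real.sqrt (1 - c ^ 2) / c) ^ 2) *
        ENNReal.ofReal (Real.pi * (1 - c ^ 2)) := by
  set ρ := Real.sqrt (1 - c ^ 2) with hρ_def
  have hρ0 : 0 ≤ ρ := Real.sqrt_nonneg _
  have hρ1 : ρ < 1 := by rw [hρ_def, Real.sqrt_lt' one_pos]; nlinarith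
  have hcρ : Real.sqrt (1 - ρ ^ 2) = c := by
    rw [hρ_def, Real.sq_sqrt (by nlinarith)]
    rw [show 1 - (1 - c ^ 2) = c ^ 2 by ring, Real.sqrt_sq hc0.le]
  have h1 : (μHE[2] : Measure (ℝ ∙ v)ᗮ) (ball 0 ρ) = ENNReal.ofReal (Real.pi * (1 - c ^ 2)) := by
    rw [euclideanHausdorffMeasure_ball_of_finrank_two hK hρ0, hρ_def, Real.sq_sqrt (by nlinarith)]
  have h2 := (lipschitzOnWith_capLift hv hρ0 hρ1).euclideanHausdorffMeasure_image_le 2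
  rw [hcρ] at h2
  refine (measure_mono (cap_subset_image_capLift hv hc0)).trans (h2.trans ?_)
  rw [h1]
  gcongr
  apply le_of_eq
  rw [ENNReal.ofReal_pow (by positivity)]
  rfl

end Measure



end Literature.MeasureTheory.Hausdorff

end
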